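import Literature.Combinatorics.HironakaPolyhedraGame.Spivakovsky1983
import HarnessLib

/-!
# E-resolution of monomial basic objects, chart-wise on fan stages (Blanco 2012, Part I, Thm. 4.6 — the monomial case)

Source.  R. Blanco, *Desingularization of binomial varieties in arbitrary characteristic. Part I. A new resolution
function and their properties*, Math. Nachr. **285** (2012) 1316–1342 [Blanco2012a]; read on the held preprint
`paper:arxiv-0902.2887` (arXiv numbering used throughout: §1 Def. 1.5–1.24, Rem. 1.12–1.14/1.23, §4 Def. 4.2, Rem. 4.5,
**Thm. 4.6** p. 18 l. 16–44; the journal's numbering was NOT verified).  Transformation law of basic objects: S. Encinas,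
O. Villamayor, *Good points and constructive resolution of singularities*, Acta Math. **181** (1998) 109–158
[EncinasVillamayor1998], Def. 1.4 (PDF p. 5).

## What is printed

`K` is an algebraically closed field of ARBITRARY characteristic (§1 opener).  A *binomial basic object along `E`* (BBOE)
is `(W, (J, c), H, E)` with `W` regular, covered by affine charts `𝔸ⁿ_K` (Def. 1.15/1.16), `E` a normal-crossing set of
regular hypersurfaces containing the coordinate hyperplanes of the charts, `J ≠ 0` a binomial (in particular: monomial)
ideal, `c ≥ 1`, `H ⊂ E`.  Its *E-singular locus* is `E-Sing(J,c) = {ξ : E-ord_ξ J ≥ c}` (Def. 1.10/1.18); a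
*transformation* blows `W` up at a permissible centre `Z ⊆ E-Sing(J,c)` — for binomial/monomial ideals every centre is
COMBINATORIAL, «the intersection of coordinate hypersurfaces defined by variables `x_i`» (Rem. 1.23; Part II Rem. 1.21) —
and replaces `(J,c)` by its controlled transform (Def. 1.22; the law of [EncinasVillamayor1998, Def. 1.4]: total transform
divided by `I(Y′)^c`, `Y′` the exceptional divisor); an *E-resolution* is a finite sequence of transformations ending
with `E-Sing(J⁽ᴺ⁾, c) = ∅` (Def. 1.24).  **Theorem 4.6** (p. 18): for every BBOE the resolution function `t` of §4 defines
centres `Z⁽ᵏ⁾ = E-Max t⁽ᵏ⁾ ⊂ E-Sing(J⁽ᵏ⁾, c)` (regular, `t` equivariant) and — part C) — «for some `r`, the previous sequence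
of transformations is an E-resolution», i.e. `E-Sing(J⁽ʳ⁾, c) = ∅`; part B)'s proviso «no hyperbolic equation
`1 − μ y^δ` among the generators» (Def. 1.8) is void for MONOMIAL `J` (Rem. 4.5 l. 12–14 puts `J = M · I`, `I` monomial,
explicitly in scope).

## What is typed here, and the DICTIONARY (stated def by def; res-lit-6 (W1)–(W8), FACT desk F-70 SHAPE 2026-08-27)

We render the MONOMIAL case CHART-WISE ON FAN STAGES — pure exponent combinatorics, no field, no scheme:
* A *position* `A : Finset (Fin n → ℚ)` (Spivakovsky's `IsPosition`: `A` non-empty, coordinates `≥ 0` — so `J ≠ 0`,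
  (W6)) stands for the monomial ideal `J_{L·A} = (x^{L v} : v ∈ A)` with marking `c = L`, `L` a common denominator of `A`;
  we NORMALISE exponents by `c`, so the threshold is `1` and all data are rational (print's data are `(ℕ-exponents, c)`;
  ours are `(A, 1) = (L·A, L)/L`).
* A *stage* is a list of corners `HConeN n` — a chart of the regular toric variety of a fan — each carrying its rays
  `r_k ∈ ℤⁿ` and INTEGER HEIGHTS `b_k` (the multiplicity of the accumulated exceptional factor along the divisor of `r_k`,
  divided by `c`); the chart ideal is monomial with generators of exponents `coordN v r b = (⟨v, r_k⟩ − b_k)_k`, `v ∈ A`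
  (the derived BOARD, `HConeN.board`).  `E` = all torus-invariant divisors (the rays), `H` is reset to `∅`.
* A *combinatorial centre* is a non-empty set of rays `R` present in the stage (Rem. 1.23): the orbit closure `V(R)`.
  LEGALITY `LegalFaceN` = «`V(R) ⊆ E-Sing(J, c)`» (Def. 1.18, Thm. 4.6 B)) = at every corner containing `R`,
  `Σ_{k ∈ slots R} a_k ≥ 1` for every board point `a` (the E-order of a monomial ideal along the stratum of `R` is the
  minimum over the generators of `Σ_{k∈R}` exponents, Def. 1.10/Rem. 1.12–1.13), i.e. Spivakovsky's `IsPermissible` of the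
  slots (W4); centres of codimension one (`|R| = 1`, a divisor) are included, as in print.
* The TRANSFORM (`HConeN.child`/`blowup`, `HStageN.blowup`) is the star subdivision at `ρ_R = Σ_{r∈R} r` with the HEIGHTS
  LAW `b(ρ_R) = 1 + Σ_{r∈R} b(r)`: on boards this is Hironaka's move `σ_{T,s}` (`gameMove_coordN`, the only theorem of this
  file) = the controlled transform «total transform ÷ `I(Y′)^c`» of [EncinasVillamayor1998, Def. 1.4] — the law's source
  (W3); Blanco's Def. 1.22 prints `I(Y′)^{θ−c} · J^∨` with `θ` the top E-order, which COINCIDES with this law on centres inside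
  `E-Max(J)` (Part I Prop. 3.28), and Blanco's monomial-case (`Γ`) steps defer to Encinas–Villamayor's course, whose law this
  is — a READING supported by the page (res-lit-1 AS-PRINTED note N3), stated here, not hidden.
* PRINT-MOVES (W5, FACT desk sharpening): the `k`-th printed move blows up `Z⁽ᵏ⁾ = E-Max t⁽ᵏ⁾` AT ONCE — a regular
  torus-invariant centre, i.e. a DISJOINT UNION of orbit closures `V(R₁) ⊔ … ⊔ V(R_m)` (disjoint ⟺ no corner contains two of
  the `R_i`).  `HStageN.blowupFamily` is exactly that simultaneous move (`LegalFamilyN`: every member legal, pairwise not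
  co-contained); `EResolvableIn`/`EResolvable` quantify over print-moves.  The SPLITTING of a print-move into single-face
  moves is NOT asserted here (it is a lemma about the model, kernel work of the consumers).
* WIN (W7) = Def. 1.24 verbatim: `E-Sing(J⁽ᴺ⁾, c) = ∅` ⟺ at every corner (the E-order is maximal at the torus-fixed point of
  each chart) some generator has `Σ_k a_k < 1`: `StrictWonN` at every corner.
* REACHABLE STAGES (W8): Thm. 4.6 is stated for every BBOE, affine or not (Def. 1.16: «covered by affine BBOE»; `t` is
  equivariant, so the chart-wise algorithm glues); the BBOE of a stage reached from the standard corner by legal single-face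
  moves (`StrictReachableN`) is such an object (regular toric variety, chart-wise monomial `J`, `E` = toric divisors,
  `H := ∅`), so the fact is stated for every strictly reachable stage; the initial-stage form is its corollary.

THE NAMED FACT `Blanco2012a_thm_4_6_monomial` is the ∃-COROLLARY of Thm. 4.6 C) under this dictionary (W1): instantiated
from print at one algebraically closed field; the combinatorial conclusion does not remember `K`.  NOT claimed: the
resolution function `t`, its equivariance, uniqueness/canonicity of the resolution, any bound on its length, anything
about binomial (non-monomial) ideals, the splitting of print-moves.  Statement-only; UNPROVED here (take
`(hB : Blanco2012a_thm_4_6_monomial)` as a hypothesis); F-70 CANDIDATE of the resolution cell's FACT desk.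
Consumers: the W-top corner cell of `Summits/ResolutionOfSingularities` (rows `InitialCornerEliminable`,
`CornerEliminable`, bridge file `…Corridor3SigmaCornerPuzzleBlancoBridge`), whose dimension-3 heights model
(res-L1-w42-idea-2 round 8, hoisted by res-type-022) this file mirrors in dimension `n` with `N`-suffixed names.
This is a Literature file: it imports no `Summits` module; no instance, no notation; typed by res-D-pv-060
(cell res-hironaka, 2026-08-27) on res-L1-w42-plan-1's CUT, wording per res-lit-6 (W1)–(W8).
-/

namespace Literature.Combinatorics.HironakaPolyhedraGame

open Finset
open scoped BigOperators

variable {n : ℕ}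

/-! ## §1  Fan stages in heights form (dimension `n`) and the chart dictionary -/

/-- The BOARD COORDINATE of the generator with normalised exponent `v` at slot `k` of a corner with rays `r` and heights `b`:
`⟨v, r_k⟩ − b_k` — the exponent of the `k`-th chart coordinate in that generator of the `c`-controlled transform, divided by
`c` (chart formula behind Def. 1.22 / [EncinasVillamayor1998, Def. 1.4]: pull back the monomial along the toric chart, then
remove the accumulated exceptional factor `x_k^{c·b_k}`).  Dimension-`n` mirror of the resolution cell's `coord`.
[cite: Blanco2012a, Def. 1.22 with Rem. 1.23 (arXiv 0902.2887 numbering)] -/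
def coordN (v : Fin n → ℚ) (r : Fin n → (Fin n → ℤ)) (b : Fin n → ℤ) : Fin n → ℚ :=
  fun k => (∑ i, v i * (r k i : ℚ)) - (b k : ℚ)

/-- A CORNER of a fan stage in heights form: an affine chart `𝔸ⁿ` of the regular toric variety of the stage (Def. 1.15/1.16:
a BBOE is covered by affine charts), recorded by its ordered rays `r_k ∈ ℤⁿ` and their integer heights `b_k` (multiplicity of
the accumulated exceptional factor along the divisor of `r_k`, in units of `c`).  [cite: Blanco2012a, Def. 1.15–1.16, Rem. 1.2] -/
structure HConeN (n : ℕ) where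
  /-- the rays of the corner, indexed by slots -/
  ray : Fin n → (Fin n → ℤ)
  /-- the heights of the rays (exceptional multiplicities in units of `c`) -/
  height : Fin n → ℤ

/-- The derived BOARD of a corner for the position `A`: the normalised exponents of the generators of the chart ideal
(`coordN` of every `v ∈ A`).  Its E-order at the torus-fixed point is `min_{a} Σ_k a_k` (Def. 1.10, Rem. 1.12–1.13).
[cite: Blanco2012a, Def. 1.10, Rem. 1.12–1.13] -/
def HConeN.board (A : Finset (Fin n → ℚ)) (c : HConeN n) : Finset (Fin n → ℚ) :=
  A.image (fun v => coordN v c.ray c.height)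

/-- The slots of the corner `c` whose rays lie in the face `R` (a face is named by its set of rays).
[cite: Blanco2012a, Rem. 1.23] -/
def HConeN.slots (c : HConeN n) (R : Finset (Fin n → ℤ)) : Finset (Fin n) :=
  Finset.univ.filter (fun s => c.ray s ∈ R)

/-- The corner `c` CONTAINS the face `R`: every ray of `R` is a ray of `c` (the chart meets the orbit closure `V(R)`, a
«combinatorial center … intersection of coordinate hypersurfaces», Rem. 1.23).  Reducible, so that containment is decidable.
[cite: Blanco2012a, Rem. 1.23] -/
abbrev HConeN.Contains (c : HConeN n) (R : Finset (Fin n → ℤ)) : Prop :=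
  R ⊆ Finset.univ.image c.ray

/-- The CHILD corner for the reply `s` of the star subdivision of the face with slots `T`: ray `s` is replaced by
`ρ_T = Σ_{t∈T} r_t` and its height by `1 + Σ_{t∈T} b(r_t)` — the HEIGHTS LAW, i.e. the chart of the blow-up in which the new
exceptional divisor is `x_s = 0`, with the controlled transform «total transform ÷ I(Y′)^c» of [EncinasVillamayor1998,
Def. 1.4] (normalised by `c`); on boards this is Hironaka's move `σ_{T,s}` (`gameMove_coordN`).
[cite: EncinasVillamayor1998, Def. 1.4 (PDF p. 5)] -/
def HConeN.child (c : HConeN n) (T : Finset (Fin n)) (s : Fin n) : HConeN n where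
  ray := Function.update c.ray s (∑ t ∈ T, c.ray t)
  height := Function.update c.height s (1 + ∑ t ∈ T, c.height t)

/-- BLOW UP the face `R` in the corner `c`: the corner is replaced by its children, one for each slot of `R` (the charts of the
blow-up of the chart `𝔸ⁿ` at `V(R)`); a corner not containing `R` is untouched.  [cite: Blanco2012a, Def. 1.22, Rem. 1.23] -/
noncomputable def HConeN.blowup (c : HConeN n) (R : Finset (Fin n → ℤ)) : List (HConeN n) :=
  if c.Contains R then ((c.slots R).toList).map (fun s => c.child (c.slots R) s) else [c]

/-- A STAGE in heights form: the list of corners (affine charts) of the regular toric variety reached so far — the non-affine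
BBOE «covered by affine BBOE» of Def. 1.16.  [cite: Blanco2012a, Def. 1.16] -/
abbrev HStageN (n : ℕ) := List (HConeN n)

/-- Blow up the face `R` EVERYWHERE in the stage: every corner containing `R` is subdivided (one global centre `V(R)`,
a closed subscheme of the stage — Def. 1.22's `Z`).  [cite: Blanco2012a, Def. 1.22] -/
noncomputable def HStageN.blowup (S : HStageN n) (R : Finset (Fin n → ℤ)) : HStageN n :=
  (S.map (fun c => c.blowup R)).flatten

/-- Blow up, in the corner `c`, the first member of the family `F` that `c` contains (for a pairwise not co-contained family —
the only case used — at most one member is contained in `c`); a corner containing no member is untouched.  Chart of the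
simultaneous blow-up of the disjoint union `⊔ V(R_i)` (Thm. 4.6 B): the centre `E-Max t` is regular and torus-invariant, hence
such a disjoint union).  [cite: Blanco2012a, Thm. 4.6 B) with Def. 4.2 (arXiv numbering)] -/
noncomputable def HConeN.blowupFamily (c : HConeN n) (F : List (Finset (Fin n → ℤ))) : List (HConeN n) :=
  match F.find? (fun R => decide (c.Contains R)) with
  | none => [c]
  | some R => c.blowup R

/-- PRINT-MOVE: blow up the whole family `F` AT ONCE, everywhere in the stage (the `k`-th transformation of Thm. 4.6 B), whose
centre `Z⁽ᵏ⁾ = E-Max t⁽ᵏ⁾` may have several components).  [cite: Blanco2012a, Thm. 4.6 B)] -/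
noncomputable def HStageN.blowupFamily (S : HStageN n) (F : List (Finset (Fin n → ℤ))) : HStageN n :=
  (S.map (fun c => c.blowupFamily F)).flatten

/-- The STANDARD CORNER, heights zero: the initial BBOE `(𝔸ⁿ_K, (J_A, c), H = ∅, E = {x₁ = 0, …, x_n = 0})` (Rem. 1.2).
[cite: Blanco2012a, Rem. 1.2] -/
def initialHStageN (n : ℕ) : HStageN n :=
  [{ ray := fun i j => if i = j then 1 else 0, height := fun _ => 0 }]

/-! ## §2  E-order clauses: strict win, legality, print-moves, E-resolvability -/

/-- STRICTLY WON board: some board point has total mass `< 1` — the E-order of the chart ideal at the torus-fixed point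
(`min_a Σ_k a_k`, Rem. 1.12–1.13) is `< c`, i.e. the chart misses `E-Sing(J, c)` (Def. 1.18); at every corner this is
`E-Sing(J, c) = ∅`, the END of an E-resolution (Def. 1.24).  [cite: Blanco2012a, Def. 1.18, Def. 1.24] -/
def StrictWonN (B : Finset (Fin n → ℚ)) : Prop :=
  ∃ a ∈ B, ∑ j, a j < 1

/-- LEGAL single-face centre at the stage `S`: the face `R` is non-empty, present in some corner (a combinatorial centre,
Rem. 1.23 — divisors `|R| = 1` included), and PERMISSIBLE at EVERY corner containing it: `Σ_{k ∈ slots R} a_k ≥ 1` for every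
board point `a` (Spivakovsky's `IsPermissible`), i.e. `V(R) ⊆ E-Sing(J, c)` (Def. 1.18; Thm. 4.6 B) «`Z⁽ᵏ⁾ ⊂ E-Sing(J⁽ᵏ⁾, c)`»;
E-order along the stratum of `R` = `min_a Σ_{k∈R} a_k`, Def. 1.10/Rem. 1.12–1.13).  Regularity and normal crossings with
`E` are automatic for orbit closures.  [cite: Blanco2012a, Def. 1.18 with Def. 1.10, Rem. 1.12–1.13, Rem. 1.23] -/
def LegalFaceN (A : Finset (Fin n → ℚ)) (S : HStageN n) (R : Finset (Fin n → ℤ)) : Prop :=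
  R.Nonempty ∧ (∃ c ∈ S, c.Contains R) ∧ ∀ c ∈ S, c.Contains R → IsPermissible (c.board A) (c.slots R)

/-- LEGAL PRINT-MOVE at the stage `S`: a non-empty family of legal faces, PAIRWISE NOT CO-CONTAINED (no corner contains two
members ⟺ the orbit closures `V(R_i)` are pairwise disjoint), so that `⊔ V(R_i)` is one regular torus-invariant centre inside
`E-Sing(J, c)` — the shape of `Z⁽ᵏ⁾ = E-Max t⁽ᵏ⁾` in Thm. 4.6 B).  [cite: Blanco2012a, Thm. 4.6 B) with Def. 4.2] -/
def LegalFamilyN (A : Finset (Fin n → ℚ)) (S : HStageN n) (F : List (Finset (Fin n → ℤ))) : Prop :=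
  F ≠ [] ∧ (∀ R ∈ F, LegalFaceN A S R) ∧
    F.Pairwise (fun R R' => ∀ c ∈ S, ¬ (c.Contains R ∧ c.Contains R'))

/-- `EResolvableIn A k S`: from the stage `S` some sequence of at most `k` legal PRINT-MOVES reaches a stage all of whose
corners are strictly won — «a E-resolution … `E-Sing(J⁽ᴺ⁾, c) = ∅`» (Def. 1.24) of length `≤ k`, by recursion on `k`.
[cite: Blanco2012a, Def. 1.24] -/
def EResolvableIn (A : Finset (Fin n → ℚ)) : ℕ → HStageN n → Prop
  | 0, S => ∀ c ∈ S, StrictWonN (c.board A)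
  | k + 1, S => (∀ c ∈ S, StrictWonN (c.board A)) ∨
      ∃ F : List (Finset (Fin n → ℤ)), LegalFamilyN A S F ∧ EResolvableIn A k (S.blowupFamily F)

/-- `EResolvable A S`: the BBOE of the stage `S` (for the position `A`) admits an E-resolution (Def. 1.24) by print-moves.
[cite: Blanco2012a, Def. 1.24] -/
def EResolvable (A : Finset (Fin n → ℚ)) (S : HStageN n) : Prop :=
  ∃ k, EResolvableIn A k S

/-- STRICTLY REACHABLE stages: those obtained from the standard corner by finitely many legal SINGLE-FACE blow-ups (a sequence
of transformations of BBOEs at combinatorial centres inside `E-Sing`, Def. 1.22; the resulting object is a — generally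
non-affine — BBOE, Def. 1.16).  [cite: Blanco2012a, Def. 1.16, Def. 1.22] -/
inductive StrictReachableN (A : Finset (Fin n → ℚ)) : HStageN n → Prop
  | init : StrictReachableN A (initialHStageN n)
  | step {S : HStageN n} (R : Finset (Fin n → ℤ)) :
      StrictReachableN A S → LegalFaceN A S R → StrictReachableN A (S.blowup R)

/-! ## §3  The one-step law (proved) -/

/-- **ONE-STEP LAW (dimension `n`).**  Hironaka's move `σ_{T,s}` applied to the board point of `v` is the board point of `v`
for the child corner (ray `s` replaced by `ρ_T = Σ_{t∈T} r_t`, height `1 + Σ_{t∈T} b(r_t)`): the chart formula of the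
controlled transform «÷ I(Y′)^c» ([EncinasVillamayor1998, Def. 1.4]) on monomial generators.  Copy of the resolution cell's
`gameMove_coord` with `3 ↦ n`.  [cite: EncinasVillamayor1998, Def. 1.4] -/
theorem gameMove_coordN (v : Fin n → ℚ) (r : Fin n → (Fin n → ℤ)) (b : Fin n → ℤ) (T : Finset (Fin n)) (s : Fin n) :
    gameMove T s (coordN v r b) =
      coordN v (Function.update r s (∑ t ∈ T, r t)) (Function.update b s (1 + ∑ t ∈ T, b t)) := by
  funext k
  by_cases hk : k = s
  · subst hk
    simp only [gameMove, coordN, if_true, Function.update_self, Finset.sum_apply, Int.cast_sum, Int.cast_add,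
      Int.cast_one, Finset.mul_sum]
    rw [Finset.sum_comm, Finset.sum_sub_distrib]
    ring
  · simp [gameMove, coordN, hk]

/-! ## §4  The named fact -/

/-- **Blanco 2012 (Part I), Thm. 4.6 — MONOMIAL CASE, chart-wise on fan stages (NAMED FACT, statement-only, UNPROVED here;
F-70 candidate).**  For `W⁽⁰⁾ = 𝔸ⁿ_K`, `K` algebraically closed of ANY characteristic, `J = J_{L·A} = (x^{L v} : v ∈ A)` monomial
(`A` a position: non-empty, coordinates `≥ 0`; `L` a common denominator), marking `c = L`, `H = ∅`, `E` = the coordinate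
hyperplanes, and for every BBOE obtained from it by legal single-face transformations (`StrictReachableN`; Def. 1.16/1.22,
with `H` reset to `∅`): Thm. 4.6 C) «for some `r`, the previous sequence of transformations is an E-resolution», i.e.
`E-Sing(J⁽ʳ⁾, c) = ∅` — rendered: `EResolvable A S`, an E-resolution by PRINT-MOVES (simultaneous blow-ups of pairwise disjoint
families of legal faces = the regular torus-invariant centres `E-Max t⁽ᵏ⁾`, Thm. 4.6 B)) ending with every corner strictly won
(Def. 1.24).  Part B)'s proviso (no hyperbolic generating equation, Def. 1.8) is void for monomial `J` (Rem. 4.5).  Transform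
law: [EncinasVillamayor1998, Def. 1.4] (coincides with Blanco's Def. 1.22 on centres in `E-Max`, Prop. 3.28; her monomial-case
steps defer to Encinas–Villamayor's course).  Instantiated from print at one algebraically closed field; the combinatorial
conclusion does not remember `K`.  NOT claimed: `t`, equivariance, uniqueness, a bound on `r`, the binomial case, the
splitting of print-moves into single-face moves.  Journal numbering (Math. Nachr. 285 (2012) 1316–1342) not verified against
the arXiv numbering used here.  [cite: Blanco2012a, Thm. 4.6 C) with B), Def. 1.16/1.18/1.22/1.24, Rem. 1.23, Rem. 4.5
(arXiv 0902.2887 numbering)] -/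
def Blanco2012a_thm_4_6_monomial : Prop :=
  ∀ (n : ℕ) (A : Finset (Fin n → ℚ)) (S : HStageN n), IsPosition A → StrictReachableN A S → EResolvable A S

end Literature.Combinatorics.HironakaPolyhedraGame
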